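import Summits.HubbardSuperconductivity.HubbardSuperconductivity.Theorems.WidthHaldaneDefs
import Literature.MathematicalPhysics.QuantumLattice.FreeFermionSectorGroundStates
import Literature.MathematicalPhysics.QuantumLattice.TorusCooperSum

/-!
# `WidthUniformThermodynamics` (stmt-HubbardSuperconductivity-16312), negative side, part 1:
# shell parity of the free square torus and the vanishing free pair compressibility

Support file of `WidthUniformThermodynamicsFalseWithoutPosU.lean` (the load-bearing analysis of the
hypothesis `0 < U` of the crux `WidthUniformThermodynamics`, route `WidthHaldane`; standing crux
disprover, cycle 1, 2026-08-17). Everything here concerns the FREE square torus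
`H₀ = hubbardTorus 2 L 1 0`, the `U = 0`, `M = L` member of the crux's tube family, and is
sorry-free:

* `odd_card_filter_torusBand_le` — **shell parity**: for even `L` and `-4 ≤ μ < 4` the sub-level
  count `#{k : ε_L(k) ≤ μ}` of the band `ε_L(k) = -2(cos k₁ + cos k₂)` (`torusBand`) is ODD. Proof:
  the involution `k ↦ -k` of the momentum torus `(ℤ/L)²` preserves `ε_L` (`torusBand_neg`); its fixed
  points are the 2-torsion points `(0,0), (0,L/2), (L/2,0), (L/2,L/2)` (`neg_eq_self_iff_coords`)
  with band values `-4, 0, 0, 4` (`torusBand_of_fixed`), of which an odd number (`1` or `3`) lies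
  below any `μ ∈ [-4, 4)` (`filter_fixed_eq`); the non-fixed points pair off (counted in `ZMod 2`).
* `exists_openShell_of_even` — hence an EVEN `n` with `0 < n < L²` is an OPEN-SHELL occupation:
  `#{ε_L < μ} < n < #{ε_L ≤ μ}` for the smallest band value `μ` whose sub-level count reaches `n`.
* `exists_three_fermiSets` — on an open shell there are nested Fermi sets of `n-1, n, n+1` lowest
  levels with common Fermi level `μ`, whose level sums differ by `μ` each (abstract levels; cf. the
  Literature lemma `exists_two_fermiSets`).
* `free_pair_second_difference_eq_zero` — therefore, by the exact free sector floor
  `minEnergyOn H₀ (szSector 2n 0) = 2 Σ_F ε_L` (`minEnergyOn_szSector_free_eq`: bathtub bound +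
  paired Fermi sea), `E₀(2n+2) + E₀(2n-2) - 2E₀(2n) = 0` for every even `0 < n < L²`, `L ≥ 3`
  even: the free pair compressibility VANISHES on even half-fillings.

Sources: J. Bardeen, L. N. Cooper, J. R. Schrieffer, Phys. Rev. 108 (1957) 1175 §II; E. H. Lieb,
M. Loss, *Analysis* (2001) Thm 1.14 (bathtub). Folklore finite-dimensional statements; the only
`def` is the half-period element `((L / 2 : ℕ) : ZMod L) = L/2` of `ZMod L`.
-/

noncomputable section

namespace Summit.HubbardSuperconductivity.HubbardSuperconductivity.Theorems.WidthUniformThermodynamics.Negative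

set_option linter.dupNamespace false

open scoped BigOperators Classical Matrix ComplexConjugate Topology
open Matrix Finset Filter Literature.MathematicalPhysics.QuantumLattice Literature.Probability.LatticeModels
open Summit.HubbardSuperconductivity.HubbardSuperconductivity.Theorems.WidthHaldane

/-! ### Shell parity of the square-torus band for even `L` -/

section Shells

variable {L : ℕ} [NeZero L]

/-- The representative of the half-period element `((L/2 : ℕ) : ZMod L)` is `L/2`. [folklore] -/
theorem val_half : (((L / 2 : ℕ) : ZMod L)).val = L / 2 := by
  rw [ZMod.val_natCast]
  exact Nat.mod_eq_of_lt (Nat.div_lt_self (NeZero.pos L) one_lt_two)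

/-- For even `L`, `2 · (L/2) = L` on representatives. [folklore] -/
theorem two_mul_val_half (hL : Even L) : 2 * (((L / 2 : ℕ) : ZMod L)).val = L := by
  rw [val_half]; exact Nat.two_mul_div_two_of_even hL

/-- For even `L ≥ 2`, `L/2 ≠ 0` in `ZMod L`. [folklore] -/
theorem half_ne_zero (hL : Even L) : ((L / 2 : ℕ) : ZMod L) ≠ 0 := by
  intro h
  have h1 := two_mul_val_half hL
  rw [h, ZMod.val_zero, mul_zero] at h1
  exact NeZero.ne L h1.symm

/-- In `ZMod L`, `L` even, `-a = a ↔ a = 0 ∨ a = L/2`. -/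
theorem neg_eq_self_iff_of_even (hL : Even L) (a : ZMod L) : -a = a ↔ a = 0 ∨ a = ((L / 2 : ℕ) : ZMod L) := by
  rw [ZMod.neg_eq_self_iff]
  constructor
  · rintro (h | h)
    · exact Or.inl h
    · right
      have hv : a.val = (((L / 2 : ℕ) : ZMod L)).val := by
        have := two_mul_val_half hL; omega
      rw [← ZMod.natCast_zmod_val a, hv, ZMod.natCast_zmod_val]
  · rintro (h | h)
    · exact Or.inl h
    · right; rw [h]; exact two_mul_val_half hL

omit [NeZero L] in
/-- A zero coordinate has lattice cosine `1`. [folklore] -/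
theorem cos_latticeMomentum_of_eq_zero {k : TorusSite 2 L} {i : Fin 2} (h : k i = 0) :
    Real.cos (latticeMomentum L k i) = 1 := by
  rw [show latticeMomentum L k i = 2 * Real.pi * ((k i).val : ℝ) / L from rfl, h, ZMod.val_zero,
    Nat.cast_zero, mul_zero, zero_div, Real.cos_zero]

/-- A coordinate `L/2` (even `L`) has lattice cosine `cos π = -1`. [folklore] -/
theorem cos_latticeMomentum_of_eq_half (hL : Even L) {k : TorusSite 2 L} {i : Fin 2} (h : k i = ((L / 2 : ℕ) : ZMod L)) :
    Real.cos (latticeMomentum L k i) = -1 := by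
  rw [show latticeMomentum L k i = 2 * Real.pi * ((k i).val : ℝ) / L from rfl, h]
  have hLr : (L : ℝ) ≠ 0 := by exact_mod_cast NeZero.ne L
  have hv : (((((L / 2 : ℕ) : ZMod L)).val : ℕ) : ℝ) = (L : ℝ) / 2 := by
    have := two_mul_val_half hL
    have h2 : (2 : ℝ) * (((((L / 2 : ℕ) : ZMod L)).val : ℕ) : ℝ) = L := by exact_mod_cast this
    linarith
  rw [hv, show 2 * Real.pi * ((L : ℝ) / 2) / L = Real.pi by field_simp]
  exact Real.cos_pi

omit [NeZero L] in
/-- The band at a coordinatewise description. -/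
theorem torusBand_two (k : TorusSite 2 L) :
    torusBand L k = -2 * (Real.cos (latticeMomentum L k 0) + Real.cos (latticeMomentum L k 1)) := by
  rw [torusBand, Fin.sum_univ_two]

/-- Fixed points of `k ↦ -k` on the momentum torus, `L` even. -/
theorem neg_eq_self_iff_coords (hL : Even L) (k : TorusSite 2 L) :
    -k = k ↔ (k 0 = 0 ∨ k 0 = ((L / 2 : ℕ) : ZMod L)) ∧ (k 1 = 0 ∨ k 1 = ((L / 2 : ℕ) : ZMod L)) := by
  rw [funext_iff, Fin.forall_fin_two]
  simp only [Pi.neg_apply, neg_eq_self_iff_of_even hL]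

/-- On a fixed point of the negation with `ε ≤ μ < 4`, not both coordinates are `L/2`; the band
value is `-4` or `0`. -/
theorem torusBand_of_fixed (hL : Even L) {k : TorusSite 2 L} (hk : -k = k) :
    (k = 0 ∧ torusBand L k = -4) ∨ (k = ![0, ((L / 2 : ℕ) : ZMod L)] ∧ torusBand L k = 0) ∨
      (k = ![((L / 2 : ℕ) : ZMod L), 0] ∧ torusBand L k = 0) ∨ (k = ![((L / 2 : ℕ) : ZMod L), ((L / 2 : ℕ) : ZMod L)] ∧ torusBand L k = 4) := by
  rw [neg_eq_self_iff_coords hL] at hk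
  obtain ⟨h0 | h0, h1 | h1⟩ := hk
  · left
    refine ⟨?_, ?_⟩
    · funext i; fin_cases i <;> simp [h0, h1]
    · rw [torusBand_two, cos_latticeMomentum_of_eq_zero h0, cos_latticeMomentum_of_eq_zero h1]; norm_num
  · right; left
    refine ⟨?_, ?_⟩
    · funext i; fin_cases i <;> simp [h0, h1]
    · rw [torusBand_two, cos_latticeMomentum_of_eq_zero h0, cos_latticeMomentum_of_eq_half hL h1]; norm_num
  · right; right; left
    refine ⟨?_, ?_⟩
    · funext i; fin_cases i <;> simp [h0, h1]
    · rw [torusBand_two, cos_latticeMomentum_of_eq_half hL h0, cos_latticeMomentum_of_eq_zero h1]; norm_num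
  · right; right; right
    refine ⟨?_, ?_⟩
    · funext i; fin_cases i <;> simp [h0, h1]
    · rw [torusBand_two, cos_latticeMomentum_of_eq_half hL h0, cos_latticeMomentum_of_eq_half hL h1]; norm_num

/-- The fixed points of the negation below a level `μ < 4`: `{0}` or `{0, (0,L/2), (L/2,0)}`. -/
theorem filter_fixed_eq (hL : Even L) {μ : ℝ} (hμ : μ < 4) (hμ' : -4 ≤ μ) :
    (univ.filter fun k : TorusSite 2 L => torusBand L k ≤ μ ∧ -k = k) =
      if (0 : ℝ) ≤ μ then {0, ![0, ((L / 2 : ℕ) : ZMod L)], ![((L / 2 : ℕ) : ZMod L), 0]} else {0} := by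
  have hb0 : torusBand L (0 : TorusSite 2 L) = -4 := by
    rw [torusBand_two, cos_latticeMomentum_of_eq_zero rfl, cos_latticeMomentum_of_eq_zero rfl]; norm_num
  have hba : torusBand L (![0, ((L / 2 : ℕ) : ZMod L)] : TorusSite 2 L) = 0 := by
    rw [torusBand_two, cos_latticeMomentum_of_eq_zero (by simp), cos_latticeMomentum_of_eq_half hL (by simp)]
    norm_num
  have hbb : torusBand L (![((L / 2 : ℕ) : ZMod L), 0] : TorusSite 2 L) = 0 := by
    rw [torusBand_two, cos_latticeMomentum_of_eq_half hL (by simp), cos_latticeMomentum_of_eq_zero (by simp)]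
    norm_num
  have hfix : ∀ k : TorusSite 2 L, (k 0 = 0 ∨ k 0 = ((L / 2 : ℕ) : ZMod L)) → (k 1 = 0 ∨ k 1 = ((L / 2 : ℕ) : ZMod L)) → -k = k :=
    fun k h0 h1 => (neg_eq_self_iff_coords hL k).2 ⟨h0, h1⟩
  ext k
  simp only [mem_filter, mem_univ, true_and]
  constructor
  · rintro ⟨hle, hk⟩
    rcases torusBand_of_fixed hL hk with ⟨rfl, h⟩ | ⟨rfl, h⟩ | ⟨rfl, h⟩ | ⟨rfl, h⟩
    · split_ifs <;> simp
    · rw [h] at hle; rw [if_pos hle]; simp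
    · rw [h] at hle; rw [if_pos hle]; simp
    · rw [h] at hle; linarith
  · intro hk
    split_ifs at hk with h0
    · simp only [mem_insert, mem_singleton] at hk
      rcases hk with rfl | rfl | rfl
      · exact ⟨by rw [hb0]; linarith, hfix _ (Or.inl rfl) (Or.inl rfl)⟩
      · exact ⟨by rw [hba]; exact h0, hfix _ (Or.inl (by simp)) (Or.inr (by simp))⟩
      · exact ⟨by rw [hbb]; exact h0, hfix _ (Or.inr (by simp)) (Or.inl (by simp))⟩
    · simp only [mem_singleton] at hk
      subst hk
      exact ⟨by rw [hb0]; linarith, hfix _ (Or.inl rfl) (Or.inl rfl)⟩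

/-- **Shell parity.** For even `L` and a level `-4 ≤ μ < 4`, the number of momenta of the `L × L`
torus with band value `≤ μ` is ODD. -/
theorem odd_card_filter_torusBand_le (hL : Even L) {μ : ℝ} (hμ : μ < 4) (hμ' : -4 ≤ μ) :
    Odd (univ.filter fun k : TorusSite 2 L => torusBand L k ≤ μ).card := by
  set S := univ.filter fun k : TorusSite 2 L => torusBand L k ≤ μ with hS
  have hsplit := Finset.card_filter_add_card_filter_not (s := S) (fun k => -k = k)
  have heven : Even (S.filter fun k => ¬ -k = k).card := by
    -- the non-fixed points pair off under `k ↦ -k` (count them in `ZMod 2`)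
    have h_mem : ∀ a ∈ S.filter (fun k => ¬ -k = k), -a ∈ S.filter (fun k => ¬ -k = k) := by
      intro a ha
      rw [mem_filter] at ha ⊢
      rw [hS, mem_filter] at ha ⊢
      refine ⟨⟨mem_univ _, by rw [torusBand_neg]; exact ha.1.2⟩, ?_⟩
      rw [neg_neg]; exact fun h => ha.2 h.symm
    have h := Finset.sum_involution (s := S.filter fun k => ¬ -k = k) (f := fun _ ↦ (1 : ZMod 2))
      (fun a _ ↦ -a) (fun a _ ↦ by decide) (fun a ha _ ↦ (mem_filter.1 ha).2) (fun a ha ↦ h_mem a ha)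
      (fun a _ ↦ neg_neg a)
    rw [Finset.sum_const, nsmul_eq_mul, mul_one] at h
    exact ZMod.natCast_eq_zero_iff_even.mp h
  have hodd : Odd (S.filter fun k => -k = k).card := by
    have heq : (S.filter fun k => -k = k) = univ.filter fun k : TorusSite 2 L => torusBand L k ≤ μ ∧ -k = k := by
      rw [hS, Finset.filter_filter]
    rw [heq, filter_fixed_eq hL hμ hμ']
    have ha0 : (![0, ((L / 2 : ℕ) : ZMod L)] : TorusSite 2 L) ≠ 0 := fun h => half_ne_zero hL (by simpa using congrFun h 1)
    have hb0 : (![((L / 2 : ℕ) : ZMod L), 0] : TorusSite 2 L) ≠ 0 := fun h => half_ne_zero hL (by simpa using congrFun h 0)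
    have hab : (![0, ((L / 2 : ℕ) : ZMod L)] : TorusSite 2 L) ≠ ![((L / 2 : ℕ) : ZMod L), 0] := fun h =>
      half_ne_zero hL (by simpa using (congrFun h 0).symm)
    split_ifs
    · rw [card_insert_of_notMem, card_insert_of_notMem, card_singleton]
      · decide
      · simpa using hab
      · simp only [mem_insert, mem_singleton, not_or]; exact ⟨ha0.symm, hb0.symm⟩
    · simp
  rw [← hsplit]
  exact Odd.add_even hodd heven

/-! ### Open shells: an even particle number sits strictly inside a shell -/

/-- **Even occupation numbers are open shells.** For even `L` and an EVEN `n` with `0 < n < L²`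
there is a level `μ` with `#{ε_L < μ} < n < #{ε_L ≤ μ}`: the `n`-th level of the `L × L` torus
band is degenerate with the `(n+1)`-st and the `n`-th electron of each spin does not close a
shell (all cumulative shell counts below the top are odd, `odd_card_filter_torusBand_le`). -/
theorem exists_openShell_of_even (hL : Even L) {n : ℕ} (hn : Even n) (hn0 : 0 < n)
    (hnL : n < L ^ 2) :
    ∃ μ : ℝ, (univ.filter fun k : TorusSite 2 L => torusBand L k < μ).card < n ∧
      n < (univ.filter fun k : TorusSite 2 L => torusBand L k ≤ μ).card := by
  -- the admissible values: band values `v` with `n ≤ #{ε ≤ v}`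
  set V : Finset ℝ := (univ.image fun k : TorusSite 2 L => torusBand L k).filter fun v =>
    n ≤ (univ.filter fun k : TorusSite 2 L => torusBand L k ≤ v).card with hV
  have hVne : V.Nonempty := by
    refine ⟨(univ.image fun k : TorusSite 2 L => torusBand L k).max' ?_, ?_⟩
    · exact ⟨_, mem_image_of_mem _ (mem_univ (0 : TorusSite 2 L))⟩
    · rw [hV, mem_filter]
      refine ⟨Finset.max'_mem _ _, ?_⟩
      have hall : (univ.filter fun k : TorusSite 2 L => torusBand L k ≤
          (univ.image fun k : TorusSite 2 L => torusBand L k).max' ⟨_, mem_image_of_mem _ (mem_univ (0 : TorusSite 2 L))⟩) = univ := by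
        refine Finset.filter_true_of_mem fun k _ => Finset.le_max' _ _ (mem_image_of_mem _ (mem_univ k))
      rw [hall, Finset.card_univ, card_torusSite_two]
      exact hnL.le
  set μ : ℝ := V.min' hVne with hμ
  have hμV : μ ∈ V := Finset.min'_mem _ _
  rw [hV, mem_filter, mem_image] at hμV
  obtain ⟨⟨k₀, -, hk₀⟩, hnle⟩ := hμV
  refine ⟨μ, ?_, ?_⟩
  · -- `#{ε < μ} < n`: otherwise the largest value below `μ` would already be admissible
    by_contra hlt
    push Not at hlt
    have hne : (univ.filter fun k : TorusSite 2 L => torusBand L k < μ).Nonempty := by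
      rw [← Finset.card_pos]; omega
    set v' : ℝ := ((univ.filter fun k : TorusSite 2 L => torusBand L k < μ).image
      fun k => torusBand L k).max' (hne.image _) with hv'
    have hv'mem := Finset.max'_mem _ (hne.image (fun k => torusBand L k))
    rw [← hv', mem_image] at hv'mem
    obtain ⟨k₁, hk₁, hk₁v⟩ := hv'mem
    have hv'lt : v' < μ := by rw [← hk₁v]; exact (mem_filter.1 hk₁).2
    have hsub : (univ.filter fun k : TorusSite 2 L => torusBand L k < μ) ⊆
        (univ.filter fun k : TorusSite 2 L => torusBand L k ≤ v') := by
      intro k hk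
      rw [mem_filter] at hk ⊢
      exact ⟨hk.1, Finset.le_max' _ _ (mem_image_of_mem _ (mem_filter.2 hk))⟩
    have hv'V : v' ∈ V := by
      rw [hV, mem_filter]
      refine ⟨?_, hlt.trans (Finset.card_le_card hsub)⟩
      rw [← hk₁v]
      exact mem_image_of_mem _ (mem_univ k₁)
    have := Finset.min'_le V v' hv'V
    rw [← hμ] at this
    linarith
  · -- `n < #{ε ≤ μ}`: `≤` by admissibility, `≠` by parity (or by `n < L²` at the top level)
    refine lt_of_le_of_ne hnle fun heq => ?_
    by_cases h4 : μ < 4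
    · have hodd := odd_card_filter_torusBand_le hL h4 (by rw [← hk₀]; exact neg_four_le_torusBand L k₀)
      rw [← heq] at hodd
      exact (Nat.not_even_iff_odd.2 hodd) hn
    · have hall : (univ.filter fun k : TorusSite 2 L => torusBand L k ≤ μ) = univ :=
        Finset.filter_true_of_mem fun k _ => (torusBand_le_four L k).trans (not_lt.1 h4)
      rw [hall, Finset.card_univ, card_torusSite_two] at heq
      omega

/-- **Three nested Fermi seas on an open shell.** If `#{ε < μ} < n < #{ε ≤ μ}` there are Fermi
sets `Fm ⊂ F ⊂ Fp` of `n - 1`, `n`, `n + 1` lowest levels, all with Fermi level `μ`, obtained by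
adding two shell momenta; their level sums differ by `μ` each. -/
theorem exists_three_fermiSets {ι : Type*} [Fintype ι] [DecidableEq ι] (ε : ι → ℝ) (μ : ℝ) (n : ℕ)
    (hlt : (univ.filter fun k => ε k < μ).card < n) (hgt : n < (univ.filter fun k => ε k ≤ μ).card) :
    ∃ Fm F Fp : Finset ι, Fm.card = n - 1 ∧ F.card = n ∧ Fp.card = n + 1 ∧
      ((∀ k ∈ Fm, ε k ≤ μ) ∧ ∀ k ∉ Fm, μ ≤ ε k) ∧ ((∀ k ∈ F, ε k ≤ μ) ∧ ∀ k ∉ F, μ ≤ ε k) ∧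
      ((∀ k ∈ Fp, ε k ≤ μ) ∧ ∀ k ∉ Fp, μ ≤ ε k) ∧
      ∑ k ∈ F, ε k = ∑ k ∈ Fm, ε k + μ ∧ ∑ k ∈ Fp, ε k = ∑ k ∈ F, ε k + μ := by
  set B : Finset ι := univ.filter fun k => ε k < μ with hB
  set A : Finset ι := univ.filter fun k => ε k ≤ μ with hA
  have hBA : B ⊆ A := fun k hk => by
    rw [hB, mem_filter] at hk
    rw [hA, mem_filter]
    exact ⟨hk.1, hk.2.le⟩
  set Sh : Finset ι := A \ B with hSh
  have hShc : Sh.card = A.card - B.card := card_sdiff_of_subset hBA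
  have hmemSh : ∀ k, k ∈ Sh ↔ ε k = μ := fun k => by
    rw [hSh, Finset.mem_sdiff, hA, hB, mem_filter, mem_filter]
    simp only [mem_univ, true_and, not_lt]
    exact ⟨fun h => le_antisymm h.1 h.2, fun h => ⟨h.le, h.ge⟩⟩
  obtain ⟨T, hTSh, hTc⟩ := exists_subset_card_eq (s := Sh) (n := n - 1 - B.card) (by omega)
  have h2 : 2 ≤ (Sh \ T).card := by rw [card_sdiff_of_subset hTSh]; omega
  obtain ⟨q, q', hq, hq', hqq'⟩ := Finset.one_lt_card_iff.1 (by omega : 1 < (Sh \ T).card)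
  rw [Finset.mem_sdiff] at hq hq'
  have hdisjT : Disjoint B T := by
    rw [disjoint_iff_ne]
    rintro k hk _ hk' rfl
    exact (Finset.mem_sdiff.1 (hTSh hk')).2 hk
  have fermi : ∀ T₀ : Finset ι, T₀ ⊆ Sh → (∀ k ∈ B ∪ T₀, ε k ≤ μ) ∧ (∀ k ∉ B ∪ T₀, μ ≤ ε k) := by
    intro T₀ hT₀
    refine ⟨fun k hk => ?_, fun k hk => ?_⟩
    · rcases mem_union.1 hk with hk | hk
      · exact (mem_filter.1 (hBA hk)).2
      · exact ((hmemSh k).1 (hT₀ hk)).le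
    · rw [mem_union, not_or, hB, mem_filter] at hk
      simpa using hk.1
  have hqBT : q ∉ B ∪ T := by
    rw [mem_union, not_or]; exact ⟨(Finset.mem_sdiff.1 hq.1).2, hq.2⟩
  have hq'BTq : q' ∉ insert q (B ∪ T) := by
    rw [mem_insert, mem_union, not_or, not_or]; exact ⟨hqq'.symm, (Finset.mem_sdiff.1 hq'.1).2, hq'.2⟩
  have hT1 : insert q T ⊆ Sh := Finset.insert_subset hq.1 hTSh
  have hT2 : insert q' (insert q T) ⊆ Sh := Finset.insert_subset hq'.1 hT1
  have he1 : insert q (B ∪ T) = B ∪ insert q T := by rw [Finset.union_insert]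
  have he2 : insert q' (insert q (B ∪ T)) = B ∪ insert q' (insert q T) := by
    rw [Finset.union_insert, Finset.union_insert]
  refine ⟨B ∪ T, insert q (B ∪ T), insert q' (insert q (B ∪ T)), ?_, ?_, ?_, fermi T hTSh,
    by rw [he1]; exact fermi _ hT1, by rw [he2]; exact fermi _ hT2, ?_, ?_⟩
  · rw [card_union_of_disjoint hdisjT]; omega
  · rw [card_insert_of_notMem hqBT, card_union_of_disjoint hdisjT]; omega
  · rw [card_insert_of_notMem hq'BTq, card_insert_of_notMem hqBT, card_union_of_disjoint hdisjT]; omega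
  · rw [sum_insert hqBT, (hmemSh q).1 hq.1, add_comm]
  · rw [sum_insert hq'BTq, (hmemSh q').1 hq'.1, add_comm]

/-- **The free pair compressibility vanishes on open shells.** For the free square torus
`H₀ = hubbardTorus 2 L 1 0` (`L ≥ 3` even) and an EVEN number `n` of electrons per spin with
`0 < n < L²`: `E₀(2n+2) + E₀(2n-2) - 2E₀(2n) = 0`, `E₀(N) = minEnergyOn H₀ (szSector N 0)` — the
`(n ± 1)`-electron Fermi seas are obtained by moving one electron pair within the open shell. -/
theorem free_pair_second_difference_eq_zero (hL3 : 3 ≤ L) (hL : Even L) {n : ℕ} (hn : Even n)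
    (hn0 : 0 < n) (hnL : n < L ^ 2) :
    (hubbardTorus 2 L 1 0).minEnergyOn (szSector (Λ := FermionTorus 2 L) (2 * (n + 1)) 0) +
        (hubbardTorus 2 L 1 0).minEnergyOn (szSector (Λ := FermionTorus 2 L) (2 * (n - 1)) 0) -
      2 * (hubbardTorus 2 L 1 0).minEnergyOn (szSector (Λ := FermionTorus 2 L) (2 * n) 0) = 0 := by
  obtain ⟨μ, hlt, hgt⟩ := exists_openShell_of_even hL hn hn0 hnL
  obtain ⟨Fm, F, Fp, hcm, hc, hcp, hFm, hF, hFp, hsm, hsp⟩ :=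
    exists_three_fermiSets (torusBand L) μ n hlt hgt
  rw [← hcp, ← hcm, ← hc, minEnergyOn_szSector_free_eq hL3 Fm μ hFm.1 hFm.2,
    minEnergyOn_szSector_free_eq hL3 F μ hF.1 hF.2, minEnergyOn_szSector_free_eq hL3 Fp μ hFp.1 hFp.2,
    hsp, hsm]
  ring

end Shells

end Summit.HubbardSuperconductivity.HubbardSuperconductivity.Theorems.WidthUniformThermodynamics.Negative

end
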